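import Summits.AnomalousDissipation.AnomalousDissipation.Theses.SteadyWeakLimit
import Literature.Analysis.FluidPDE.ReynoldsDefectMeasure
import Literature.Analysis.FunctionSpaces.TorusFluidGlueProofs
import Literature.Analysis.FunctionSpaces.TorusWeakFormBookkeeping

/-!
# Route SteadyWeakLimit — the support `WeakLimitSubsolution` (structure of the weak limit)

Item stmt-AnomalousDissipation-1340 (informal in the route file until the definition
`Literature.Analysis.FluidPDE.Torus.IsReynoldsDefectOf` landed): along any `L²`-bounded family of
STEADY classical Navier–Stokes states `u j` on `T^d` (fixed force `f`, viscosities `ν j → 0`)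
converging weakly in `L²` to `v` (pairings with smooth fields), every Reynolds defect measure `R`
of a subsequence (`u (φ n) ⊗ u (φ n) dx ⇀* v ⊗ v dx + R`, DiPerna–Majda) makes `(v, R)` a
stationary Euler–Reynolds subsolution with source `f`,
`∫ (⟪v, (v·∇)w⟫ + ⟪f, w⟫) dx + ∫ ∇w : dR = 0` for smooth divergence-free `w`, `v` weakly
divergence free, `R ⪰ 0`, and the energy defect is the trace mass,
`∫ |u (φ n)|² → ∫ |v|² + tr R (T^d)`.

Mathematics (De Lellis–Székelyhidi 2012, §2.2; DiPerna–Majda 1987, §1; Temam 1984, Ch. II §1.2):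
* steady classical states satisfy the stationary weak momentum identity
  `∫ (⟪u, (u·∇)w⟫ + ⟪f, w⟫) + ν ∫ ⟪u, Δw⟫ = 0` (test the pointwise equation with `w`, move all
  derivatives to `w`: antisymmetry of the trilinear form, Green's identity, `∫ ⟪∇p, w⟫ = 0`);
* `∫ ⟪u, (u·∇)w⟫ = ∑ᵢⱼ ∫ ∂ⱼwᵢ uᵢ uⱼ`, so along a Reynolds defect the convective pairing converges
  to `∫ ⟪v, (v·∇)w⟫ + ∫ ∇w : dR`; the viscous term is `ν n · O(1) → 0`; `∫ ⟪f, w⟫` is constant;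
* weak divergence-freeness passes to weak limits; the energy identity is
  `IsReynoldsDefectOf.tendsto_integral_norm_sq`.

The existence of a Reynolds defect along a subsequence is DiPerna–Majda's theorem, the named
fact `Literature.Analysis.FluidPDE.Torus.exists_isReynoldsDefectOf_subseq`; the final corollary
takes it as a hypothesis (conditional form) — its discharge is filed separately.
-/

namespace Summit.AnomalousDissipation.AnomalousDissipation.Theorems

-- the mandated namespace `Summit.<Summit>.<Problem>.Theorems` repeats `AnomalousDissipation` (single-problem summit)
set_option linter.dupNamespace false

open MeasureTheory Filter Topology
open scoped InnerProductSpace ENNReal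
open Literature.Analysis.FunctionSpaces Literature.Analysis.FunctionSpaces.Torus
open Literature.Analysis.FluidPDE Literature.Analysis.FluidPDE.Torus

section General

variable {d : Type*} [Fintype d] [DecidableEq d]

/-- **Steady classical states: the force is determined by the state.** For a classical solution of
`NS_ν(g)` on the time set `univ` which is constant in time, `g = (u·∇)u - νΔu + ∇q` pointwise
(the time derivative of a constant path vanishes). [folklore] -/
theorem steadyWeakLimit_force_eq {ν : ℝ} {g u : UnitAddTorus d → EuclideanSpace ℝ d}
    {q : UnitAddTorus d → ℝ}
    (h : IsClassicalNSSolutionOn Set.univ ν (fun _ => g) (fun _ => u) (fun _ => q)) :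
    g = fun x => convect u u x - ν • laplacian u x + gradient q x := by
  funext x
  have hm := h.momentum 0 (Set.mem_univ _) x
  have ht : Torus.timeDerivWithin Set.univ (fun _ : ℝ => u) 0 x = 0 := by
    simp [Torus.timeDerivWithin]
  rw [ht, zero_add] at hm
  rw [hm]
  abel

/-- Steady classical states are smooth (time slices of jointly smooth fields). [folklore] -/
theorem steadyWeakLimit_isSmooth_state {ν : ℝ} {g u : UnitAddTorus d → EuclideanSpace ℝ d}
    {q : UnitAddTorus d → ℝ}
    (h : IsClassicalNSSolutionOn Set.univ ν (fun _ => g) (fun _ => u) (fun _ => q)) :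
    IsSmooth u :=
  h.smooth_velocity.isSmooth_slice (Set.mem_univ (0 : ℝ))

/-- Steady classical states have smooth pressure. [folklore] -/
theorem steadyWeakLimit_isSmooth_pressure {ν : ℝ} {g u : UnitAddTorus d → EuclideanSpace ℝ d}
    {q : UnitAddTorus d → ℝ}
    (h : IsClassicalNSSolutionOn Set.univ ν (fun _ => g) (fun _ => u) (fun _ => q)) :
    IsSmooth q :=
  h.smooth_pressure.isSmooth_slice (Set.mem_univ (0 : ℝ))

/-- The force of a steady classical state is smooth. [folklore] -/
theorem steadyWeakLimit_isSmooth_force {ν : ℝ} {g u : UnitAddTorus d → EuclideanSpace ℝ d}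
    {q : UnitAddTorus d → ℝ}
    (h : IsClassicalNSSolutionOn Set.univ ν (fun _ => g) (fun _ => u) (fun _ => q)) :
    IsSmooth g := by
  have hu := steadyWeakLimit_isSmooth_state h
  have hq := steadyWeakLimit_isSmooth_pressure h
  rw [steadyWeakLimit_force_eq h]
  exact ((hu.convect hu).sub ((hu.laplacian).smul ν)).add hq.gradient

/-- **Stationary weak momentum identity of steady classical Navier–Stokes states.** If `(u, q)`
is a classical solution of `NS_ν(g)` on `T^d`, constant in time, then for every smooth
divergence-free `w`,
`∫ (⟪u, (u·∇)w⟫ + ⟪g, w⟫) + ν ∫ ⟪u, Δw⟫ = 0`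
(pair `(u·∇)u + ∇q = νΔu + g` with `w`; `∫ ⟪(u·∇)u, w⟫ = -∫ ⟪u, (u·∇)w⟫` by antisymmetry of the
trilinear form, `∫ ⟪Δu, w⟫ = ∫ ⟪u, Δw⟫`, `∫ ⟪∇q, w⟫ = 0`; Temam 1984, Ch. II §1.2; the sign
convention of `Torus.IsWeakNSSolutionOn`). [folklore] -/
theorem steadyWeakLimit_steady_weak_momentum {ν : ℝ} {g u : UnitAddTorus d → EuclideanSpace ℝ d}
    {q : UnitAddTorus d → ℝ}
    (h : IsClassicalNSSolutionOn Set.univ ν (fun _ => g) (fun _ => u) (fun _ => q))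
    {w : UnitAddTorus d → EuclideanSpace ℝ d} (hw : IsSmooth w) (hwdiv : IsDivFree w) :
    (∫ x, (⟪u x, convect u w x⟫_ℝ + ⟪g x, w x⟫_ℝ)) + ν * ∫ x, ⟪u x, laplacian w x⟫_ℝ = 0 := by
  have hu := steadyWeakLimit_isSmooth_state h
  have hq := steadyWeakLimit_isSmooth_pressure h
  have hdiv : IsDivFree u := h.divFree 0 (Set.mem_univ _)
  have hg : ∀ x, ⟪g x, w x⟫_ℝ =
      ⟪convect u u x, w x⟫_ℝ - ν * ⟪laplacian u x, w x⟫_ℝ + ⟪gradient q x, w x⟫_ℝ := by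
    intro x
    rw [steadyWeakLimit_force_eq h]
    simp only [inner_add_left, inner_sub_left, real_inner_smul_left]
  have hgs : IsSmooth g := steadyWeakLimit_isSmooth_force h
  have hi1 : Integrable (fun x => ⟪u x, convect u w x⟫_ℝ) volume :=
    (hu.inner (hu.convect hw)).integrable
  have hi2 : Integrable (fun x => ⟪convect u u x, w x⟫_ℝ) volume :=
    ((hu.convect hu).inner hw).integrable
  have hi3 : Integrable (fun x => ν * ⟪laplacian u x, w x⟫_ℝ) volume :=
    ((hu.laplacian.inner hw).integrable).const_mul ν
  have hi4 : Integrable (fun x => ⟪gradient q x, w x⟫_ℝ) volume :=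
    (hq.gradient.inner hw).integrable
  have e1 : ∫ x, (⟪u x, convect u w x⟫_ℝ + ⟪g x, w x⟫_ℝ) =
      (∫ x, ⟪u x, convect u w x⟫_ℝ) + ∫ x, ⟪g x, w x⟫_ℝ :=
    integral_add hi1 (hgs.inner hw).integrable
  have e2 : ∫ x, ⟪g x, w x⟫_ℝ =
      (∫ x, ⟪convect u u x, w x⟫_ℝ) - ν * (∫ x, ⟪laplacian u x, w x⟫_ℝ) +
        ∫ x, ⟪gradient q x, w x⟫_ℝ := by
    rw [integral_congr_ae (ae_of_all _ hg),
      integral_add (f := fun x => ⟪convect u u x, w x⟫_ℝ - ν * ⟪laplacian u x, w x⟫_ℝ)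
        (hi2.sub hi3) hi4, integral_sub hi2 hi3, integral_const_mul]
  rw [e1, e2, integral_inner_convect_eq_neg hu hdiv hu hw, integral_inner_laplacian_comm hu hw,
    integral_inner_gradient_eq_zero_of_isDivFree hw hq hwdiv]
  ring

/-- The convective pairing expanded in components:
`⟪a, (a·∇)w⟫(x) = ∑ᵢ ∑ⱼ ∂ⱼwᵢ(x) aᵢ(x) aⱼ(x)` for `C¹` `w`. [folklore] -/
theorem steadyWeakLimit_inner_convect_eq_sum_sum {a w : UnitAddTorus d → EuclideanSpace ℝ d}
    (hw : IsContDiff 1 w) (x : UnitAddTorus d) :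
    ⟪a x, convect a w x⟫_ℝ = ∑ i, ∑ j, partialDeriv j w x i * (a x i * a x j) := by
  rw [inner_convect_eq_sum hw, Finset.sum_comm]
  refine Finset.sum_congr rfl fun j _ => ?_
  rw [PiLp.inner_apply, Finset.mul_sum]
  refine Finset.sum_congr rfl fun i _ => ?_
  simp only [RCLike.inner_apply, conj_trivial]
  ring

/-- A uniform bound for the entries `∂ⱼ wᵢ` of the gradient of a smooth field on the compact
torus. [folklore] -/
theorem steadyWeakLimit_exists_bound_partialDeriv {w : UnitAddTorus d → EuclideanSpace ℝ d}
    (hw : IsSmooth w) : ∃ C : ℝ, ∀ x i j, ‖partialDeriv j w x i‖ ≤ C := by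
  obtain ⟨C, hC⟩ := (HasCompactSupport.of_compactSpace
      (fun x => ∑ i, ∑ j, ‖partialDeriv j w x i‖)).exists_bound_of_continuous
    (continuous_finsetSum _ fun i _ => continuous_finsetSum _ fun j _ =>
      ((hw.partialDeriv j).apply i).continuous.norm)
  refine ⟨C, fun x i j => ?_⟩
  refine le_trans ?_ ((Real.le_norm_self _).trans (hC x))
  refine le_trans ?_ (Finset.single_le_sum
    (f := fun i => ∑ j, ‖partialDeriv j w x i‖)
    (fun i _ => Finset.sum_nonneg fun j _ => norm_nonneg _) (Finset.mem_univ i))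
  exact Finset.single_le_sum (f := fun j => ‖partialDeriv j w x i‖)
    (fun j _ => norm_nonneg _) (Finset.mem_univ j)

/-- The entries `∂ⱼwᵢ aᵢ aⱼ` of the convective pairing of an `L²` field against a smooth field
are integrable. [folklore] -/
theorem steadyWeakLimit_integrable_partialDeriv_mul {a w : UnitAddTorus d → EuclideanSpace ℝ d}
    (ha : MemLp a 2 volume) (hw : IsSmooth w) (i j : d) :
    Integrable (fun x => partialDeriv j w x i * (a x i * a x j)) volume := by
  obtain ⟨C, hC⟩ := steadyWeakLimit_exists_bound_partialDeriv hw
  exact (integrable_apply_mul_apply_of_memLp_two ha i j).bdd_mul (c := C)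
    ((hw.partialDeriv j).apply i).continuous.aestronglyMeasurable (ae_of_all _ fun x => hC x i j)

/-- The convective pairing `x ↦ ⟪a, (a·∇)w⟫` of an `L²` field against a smooth field is
integrable. [folklore] -/
theorem steadyWeakLimit_integrable_inner_convect {a w : UnitAddTorus d → EuclideanSpace ℝ d}
    (ha : MemLp a 2 volume) (hw : IsSmooth w) :
    Integrable (fun x => ⟪a x, convect a w x⟫_ℝ) volume := by
  have h : (fun x => ⟪a x, convect a w x⟫_ℝ) =
      fun x => ∑ i, ∑ j, partialDeriv j w x i * (a x i * a x j) :=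
    funext fun x => steadyWeakLimit_inner_convect_eq_sum_sum (hw.isContDiff (by simp)) x
  rw [h]
  exact integrable_finsetSum _ fun i _ => integrable_finsetSum _ fun j _ =>
    steadyWeakLimit_integrable_partialDeriv_mul ha hw i j

/-- The convective pairing of an `L²` field against a smooth field, as a double sum of
integrals: `∫ ⟪a, (a·∇)w⟫ = ∑ᵢ ∑ⱼ ∫ ∂ⱼwᵢ aᵢ aⱼ`. [folklore] -/
theorem steadyWeakLimit_integral_inner_convect_eq_sum_sum {a w : UnitAddTorus d → EuclideanSpace ℝ d}
    (ha : MemLp a 2 volume) (hw : IsSmooth w) :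
    ∫ x, ⟪a x, convect a w x⟫_ℝ = ∑ i, ∑ j, ∫ x, partialDeriv j w x i * (a x i * a x j) := by
  have hint := steadyWeakLimit_integrable_partialDeriv_mul ha hw
  simp_rw [steadyWeakLimit_inner_convect_eq_sum_sum (hw.isContDiff (by simp))]
  rw [integral_finsetSum _ fun i _ => integrable_finsetSum _ fun j _ => hint i j]
  exact Finset.sum_congr rfl fun i _ => integral_finsetSum _ fun j _ => hint i j

/-- **The convective pairing along a Reynolds defect.** If `R` is the Reynolds defect of `(a n)`
about `v` (all fields in `L²`), then for every smooth `w`,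
`∫ ⟪a n, (a n·∇)w⟫ → ∫ ⟪v, (v·∇)w⟫ + ∫ ∇w : dR`
(entrywise: `∫ ∂ⱼwᵢ (a n)ᵢ (a n)ⱼ → ∫ ∂ⱼwᵢ vᵢ vⱼ + ∫ ∂ⱼwᵢ d(R i j)`; De Lellis–Székelyhidi 2012,
§2.2). [folklore] -/
theorem steadyWeakLimit_tendsto_integral_inner_convect
    {a : ℕ → UnitAddTorus d → EuclideanSpace ℝ d} {v : UnitAddTorus d → EuclideanSpace ℝ d}
    {R : MatrixMeasure d (UnitAddTorus d)} (hR : IsReynoldsDefectOf a v R)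
    (ha : ∀ n, MemLp (a n) 2 volume) (hv : MemLp v 2 volume)
    {w : UnitAddTorus d → EuclideanSpace ℝ d} (hw : IsSmooth w) :
    Tendsto (fun n => ∫ x, ⟪a n x, convect (a n) w x⟫_ℝ) atTop
      (𝓝 ((∫ x, ⟪v x, convect v w x⟫_ℝ) + defectPairing R w)) := by
  have hlim : (∫ x, ⟪v x, convect v w x⟫_ℝ) + defectPairing R w =
      ∑ i, ∑ j, ((∫ x, partialDeriv j w x i * (v x i * v x j)) +
        ∫ᵛ x, partialDeriv j w x i ∂<•(R i j)) := by
    rw [steadyWeakLimit_integral_inner_convect_eq_sum_sum hv hw, defectPairing,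
      MatrixMeasure.pairing]
    simp only [Matrix.of_apply]
    rw [← Finset.sum_add_distrib]
    refine Finset.sum_congr rfl fun i _ => ?_
    rw [← Finset.sum_add_distrib]
  have hfun : (fun n => ∫ x, ⟪a n x, convect (a n) w x⟫_ℝ) =
      fun n => ∑ i, ∑ j, ∫ x, partialDeriv j w x i * (a n x i * a n x j) :=
    funext fun n => steadyWeakLimit_integral_inner_convect_eq_sum_sum (ha n) hw
  rw [hlim, hfun]
  exact tendsto_finsetSum _ fun i _ => tendsto_finsetSum _ fun j _ =>
    hR.tendsto ((hw.partialDeriv j).apply i).continuous i j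

/-- **Weak limits of weakly divergence-free smooth fields are weakly divergence free**: if every
`a n` is smooth and divergence free and `∫ ⟪w, a n⟫ → ∫ ⟪w, v⟫` for smooth `w`, then
`∫ ⟪v, ∇θ⟫ = 0` for smooth `θ`. [folklore] -/
theorem steadyWeakLimit_isWeaklyDivFree_of_tendsto
    {a : ℕ → UnitAddTorus d → EuclideanSpace ℝ d} {v : UnitAddTorus d → EuclideanSpace ℝ d}
    (ha : ∀ n, IsSmooth (a n)) (hdiv : ∀ n, IsDivFree (a n))
    (hweak : ∀ w : UnitAddTorus d → EuclideanSpace ℝ d, IsSmooth w →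
      Tendsto (fun n => ∫ x, ⟪w x, a n x⟫_ℝ) atTop (𝓝 (∫ x, ⟪w x, v x⟫_ℝ))) :
    IsWeaklyDivFree v := by
  intro θ hθ
  have h1 := hweak (gradient θ) hθ.gradient
  have h0 : ∀ n, ∫ x, ⟪gradient θ x, a n x⟫_ℝ = 0 := by
    intro n
    have := IsDivFree.isWeaklyDivFree_holds (ha n) (hdiv n) θ hθ
    simpa only [real_inner_comm] using this
  simp_rw [h0] at h1
  have h2 : ∫ x, ⟪gradient θ x, v x⟫_ℝ = 0 :=
    (tendsto_nhds_unique tendsto_const_nhds h1).symm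
  simpa only [real_inner_comm] using h2

/-- **Structure of the weak limit of steady Navier–Stokes states (given a Reynolds defect).**
Let `(u n, p n)` be steady classical solutions of `NS_{ν n}(f)` on `T^d` with `ν n → 0`,
converging weakly in `L²` to `v ∈ L²` (pairings with smooth fields), and let `R` be a Reynolds
defect of `(u n)` about `v`. Then `(v, R)` is a stationary Euler–Reynolds subsolution with source
`f`: `v` is weakly divergence free, `R ⪰ 0`, and
`∫ (⟪v, (v·∇)w⟫ + ⟪f, w⟫) + ∫ ∇w : dR = 0` for every smooth divergence-free `w`
(De Lellis–Székelyhidi 2012, §2.2; DiPerna–Majda 1987, §1). [folklore] -/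
theorem steadyWeakLimit_subsolution_of_isReynoldsDefectOf
    {f : UnitAddTorus d → EuclideanSpace ℝ d} {ν : ℕ → ℝ}
    {u : ℕ → UnitAddTorus d → EuclideanSpace ℝ d} {p : ℕ → UnitAddTorus d → ℝ}
    {v : UnitAddTorus d → EuclideanSpace ℝ d} {R : MatrixMeasure d (UnitAddTorus d)}
    (hν : Tendsto ν atTop (𝓝 0))
    (hNS : ∀ n, IsClassicalNSSolutionOn Set.univ (ν n) (fun _ => f) (fun _ => u n) (fun _ => p n))
    (hv : MemLp v 2 volume)
    (hweak : ∀ w : UnitAddTorus d → EuclideanSpace ℝ d, IsSmooth w →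
      Tendsto (fun n => ∫ x, ⟪w x, u n x⟫_ℝ) atTop (𝓝 (∫ x, ⟪w x, v x⟫_ℝ)))
    (hR : IsReynoldsDefectOf u v R) :
    IsSteadyEulerReynoldsSubsolution f v R := by
  have hu : ∀ n, IsSmooth (u n) := fun n => steadyWeakLimit_isSmooth_state (hNS n)
  have hdiv : ∀ n, IsDivFree (u n) := fun n => (hNS n).divFree 0 (Set.mem_univ _)
  refine ⟨hv, steadyWeakLimit_isWeaklyDivFree_of_tendsto hu hdiv hweak, hR.isPosSemidef,
    fun w hw hwdiv => ?_⟩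
  have hf : IsSmooth f := steadyWeakLimit_isSmooth_force (hNS 0)
  -- the identity at level `n`
  have hidn : ∀ n, (∫ x, ⟪u n x, convect (u n) w x⟫_ℝ) + (∫ x, ⟪f x, w x⟫_ℝ) +
      ν n * ∫ x, ⟪u n x, laplacian w x⟫_ℝ = 0 := by
    intro n
    have h := steadyWeakLimit_steady_weak_momentum (hNS n) hw hwdiv
    rwa [integral_add ((hu n).inner ((hu n).convect hw)).integrable (hf.inner hw).integrable] at h
  -- convergence of the three terms
  have h1 := steadyWeakLimit_tendsto_integral_inner_convect hR (fun n => (hu n).memLp 2) hv hw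
  have h2 : Tendsto (fun n => ν n * ∫ x, ⟪u n x, laplacian w x⟫_ℝ) atTop (𝓝 0) := by
    have e1 : ∀ a : UnitAddTorus d → EuclideanSpace ℝ d,
        ∫ x, ⟪a x, laplacian w x⟫_ℝ = ∫ x, ⟪laplacian w x, a x⟫_ℝ := fun a =>
      integral_congr_ae (ae_of_all _ fun x => real_inner_comm _ _)
    have h3 : Tendsto (fun n => ∫ x, ⟪u n x, laplacian w x⟫_ℝ) atTop
        (𝓝 (∫ x, ⟪v x, laplacian w x⟫_ℝ)) := by
      rw [show (fun n => ∫ x, ⟪u n x, laplacian w x⟫_ℝ) = fun n => ∫ x, ⟪laplacian w x, u n x⟫_ℝ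
        from funext fun n => e1 (u n), e1 v]
      exact hweak (laplacian w) hw.laplacian
    have := hν.mul h3
    rwa [zero_mul] at this
  have hsum := (h1.add_const (∫ x, ⟪f x, w x⟫_ℝ)).add h2
  rw [add_zero] at hsum
  have hlim0 := tendsto_nhds_unique hsum (tendsto_const_nhds.congr fun n => (hidn n).symm)
  -- assemble
  rw [integral_add (steadyWeakLimit_integrable_inner_convect hv hw) (hf.inner hw).integrable]
  linarith [hlim0]

/-- **Structure of the weak limit along a subsequence (given DiPerna–Majda).** Assume the
DiPerna–Majda existence of Reynolds defect measures on `T^d` (the named fact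
`Torus.exists_isReynoldsDefectOf_subseq d`). Let `(u n, p n)` be steady classical solutions of
`NS_{ν n}(f)` with `ν n → 0`, `∫ |u n|² ≤ C`, converging weakly in `L²` to `v ∈ L²`. Then a
subsequence `u ∘ φ` has a Reynolds defect `R ⪰ 0` (`u (φ n) ⊗ u (φ n) dx ⇀* v ⊗ v dx + R`),
`(v, R)` is a stationary Euler–Reynolds subsolution with source `f`, and the energy defect is the
trace mass: `∫ |u (φ n)|² → ∫ |v|² + tr R (T^d)` (DiPerna–Majda 1987, §1; De Lellis–Székelyhidi
2012, §2.2; Majda–Bertozzi 2002, (11.18)). [folklore] -/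
theorem steadyWeakLimit_weakLimitSubsolution_of_exists_defect
    (hDM : exists_isReynoldsDefectOf_subseq d)
    {f : UnitAddTorus d → EuclideanSpace ℝ d} {ν : ℕ → ℝ}
    {u : ℕ → UnitAddTorus d → EuclideanSpace ℝ d} {p : ℕ → UnitAddTorus d → ℝ}
    {v : UnitAddTorus d → EuclideanSpace ℝ d} {C : ℝ}
    (hν : Tendsto ν atTop (𝓝 0))
    (hNS : ∀ n, IsClassicalNSSolutionOn Set.univ (ν n) (fun _ => f) (fun _ => u n) (fun _ => p n))
    (hC : ∀ n, ∫ x, ‖u n x‖ ^ 2 ≤ C) (hv : MemLp v 2 volume)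
    (hweak : ∀ w : UnitAddTorus d → EuclideanSpace ℝ d, IsSmooth w →
      Tendsto (fun n => ∫ x, ⟪w x, u n x⟫_ℝ) atTop (𝓝 (∫ x, ⟪w x, v x⟫_ℝ))) :
    ∃ φ : ℕ → ℕ, StrictMono φ ∧ ∃ R : MatrixMeasure d (UnitAddTorus d),
      IsReynoldsDefectOf (u ∘ φ) v R ∧ IsSteadyEulerReynoldsSubsolution f v R ∧
        Tendsto (fun n => ∫ x, ‖u (φ n) x‖ ^ 2) atTop (𝓝 ((∫ x, ‖v x‖ ^ 2) + R.traceMass)) := by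
  have hu : ∀ n, IsSmooth (u n) := fun n => steadyWeakLimit_isSmooth_state (hNS n)
  obtain ⟨φ, hφ, R, hR⟩ := hDM u v C (fun n => (hu n).memLp 2) hC hv hweak
  refine ⟨φ, hφ, R, hR, ?_, ?_⟩
  · exact steadyWeakLimit_subsolution_of_isReynoldsDefectOf (u := u ∘ φ) (p := p ∘ φ)
      (hν.comp hφ.tendsto_atTop) (fun n => hNS (φ n)) hv
      (fun w hw => (hweak w hw).comp hφ.tendsto_atTop) hR
  · exact hR.tendsto_integral_norm_sq (fun n => (hu (φ n)).memLp 2) hv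

end General

/-! ## The three-dimensional statement of the route -/

/-- **`WeakLimitSubsolution` (route SteadyWeakLimit, item stmt-AnomalousDissipation-1340), in the
form the route's informal text describes, conditional on DiPerna–Majda.** On `T³`: along any
`L²`-bounded family of steady classical Navier–Stokes states `u j` (fixed force `f`, `ν j → 0`)
with `u j ⇀ v` weakly in `L²`, a subsequence has a Reynolds defect measure `R` (finite, symmetric,
positive semidefinite, matrix-valued), `(v, R)` is a stationary Euler–Reynolds subsolution with
source `f` — `∫ (⟪v, (v·∇)w⟫ + ⟪f, w⟫) + ∫ ∇w : dR = 0` for smooth divergence-free `w` — and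
`tr R (T³) = lim ∫ |u (φ n)|² - ∫ |v|²`. The hypothesis is the named fact
`Torus.exists_isReynoldsDefectOf_subseq (Fin 3)` (DiPerna–Majda 1987, Thm. 1). [folklore] -/
theorem steadyWeakLimit_weakLimitSubsolution
    (hDM : exists_isReynoldsDefectOf_subseq (Fin 3))
    (f : UnitAddTorus (Fin 3) → EuclideanSpace ℝ (Fin 3)) (ν : ℕ → ℝ)
    (u : ℕ → UnitAddTorus (Fin 3) → EuclideanSpace ℝ (Fin 3)) (p : ℕ → UnitAddTorus (Fin 3) → ℝ)
    (v : UnitAddTorus (Fin 3) → EuclideanSpace ℝ (Fin 3))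
    (hν : Tendsto ν atTop (𝓝 0))
    (hNS : ∀ j, IsClassicalNSSolutionOn Set.univ (ν j) (fun _ => f) (fun _ => u j) (fun _ => p j))
    (hE : ∃ E : ℝ, ∀ j, ∫ x, ‖u j x‖ ^ 2 ≤ E) (hv : MemLp v 2 volume)
    (hweak : ∀ w : UnitAddTorus (Fin 3) → EuclideanSpace ℝ (Fin 3), IsSmooth w →
      Tendsto (fun j => ∫ x, ⟪w x, u j x⟫_ℝ) atTop (𝓝 (∫ x, ⟪w x, v x⟫_ℝ))) :
    ∃ φ : ℕ → ℕ, StrictMono φ ∧ ∃ R : MatrixMeasure (Fin 3) (UnitAddTorus (Fin 3)),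
      IsReynoldsDefectOf (u ∘ φ) v R ∧ IsSteadyEulerReynoldsSubsolution f v R ∧
        Tendsto (fun n => ∫ x, ‖u (φ n) x‖ ^ 2) atTop (𝓝 ((∫ x, ‖v x‖ ^ 2) + R.traceMass)) := by
  obtain ⟨C, hC⟩ := hE
  exact steadyWeakLimit_weakLimitSubsolution_of_exists_defect hDM hν hNS hC hv hweak

end Summit.AnomalousDissipation.AnomalousDissipation.Theorems
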